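import Literature.Probability.RandomPlanarGeometry.SLEKappaRhoHullMeasurable
import Literature.Probability.RandomPlanarGeometry.SLEKappaRhoJetControlExists
import Mathlib.MeasureTheory.Function.SpecialFunctions.Basic
import HarnessLib

/-!
# The jets of `log M_t` are random variables

G. F. Lawler, O. Schramm, W. Werner, *Conformal restriction: the chordal case*, J. Amer. Math.
Soc. **16** (2003) 917–955 (**[LSW]**), §8.4, proof of Lemma 8.9. In divided-difference
coordinates `log M = ℓ(E)(x, y) = (5/8) log E'(x) + b log E'(y) + c log DQ E x y` at
`(x, y) = (0, O_t − W_t)` (`E = E_{B_t}`, `B_t = A_t − W_t`; `SLEKappaRhoLogGamma`), the Itô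
expansion of `log M_t` involves the jets `ℓ₁ = ∂ₓℓ`, `m₁ = ∂_yℓ`, `ℓ₂ = ∂ₓ²ℓ` at `(0, O_t − W_t)`.
This file proves that these jets, multiplied by the indicator of the event that `A` is alive at
time `t`, are MEASURABLE functions of the driving path (for a family of continuous driving
functions from `0` with measurable values up to time `t` and a measurable `o ≤ 0` playing the role
of `O_t − W_t`):

* `Loewner.measurable_indicator_ell_slidHull` — `ω ↦ ℓ(E_{B_t(ω)})(x(ω), y(ω)) 𝟙{alive}` is
  measurable for measurable real `x, y ≤ 0`: at real points off the hull `E`, `E'` are real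
  (`starMap_ofReal_eq_re'`, `deriv_starMap_ofReal_eq_re`) and measurable
  (`SLEKappaRhoHullMeasurable`), and `ℓ` is an explicit expression in them;
* `tendsto_slope_ell_left`, `tendsto_secondDiff_ell_left`, `tendsto_slope_ell_right` — for a
  `+`-hull `B` and `o ≤ 0`, the one-sided difference quotients of `ℓ(E_B)` along `hₙ = 1/(n+1)`
  converge to `ℓ₁`, `ℓ₂`, `m₁` (second-order Taylor expansion `norm_ell_sub_ell_sub_le` under a jet
  control, which exists by `IsPlusHull.exists_jetControl`);
* `Loewner.measurable_indicator_jetL1_slidHull`, `…jetL2…`, `…jetM1…` — **the jets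
  `∂ₓℓ(0, o)`, `∂ₓ²ℓ(0, o)`, `∂_yℓ(0, o)` of `log M_t` (times `𝟙{alive}`) are measurable**, as
  pointwise limits of the measurable difference quotients.

No named facts.
-/

noncomputable section

open Set Filter MeasureTheory Metric Complex
open scoped NNReal Topology

namespace Literature.Probability.RandomPlanarGeometry

open SLEKappaRho

/-! ### The difference quotients of `ℓ(E_B)` converge to the jets (deterministic) -/

section Limits

variable {B : Set ℂ}

/-- `0 < hₙ ≤ 1`. [folklore] -/
theorem stepSeq_pos (n : ℕ) : (0 : ℝ) < 1 / ((n : ℝ) + 1) := by positivity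

/-- **`(ℓ(0, o) − ℓ(−hₙ, o))/hₙ → ∂ₓℓ(0, o)`** for a `+`-hull and `o ≤ 0`. [folklore] -/
theorem tendsto_slope_ell_left (hB : IsPlusHull B) (ρ : ℝ) {o : ℝ} (ho : o ≤ 0) :
    Tendsto (fun n : ℕ ↦ (ell (starMap B) ρ 0 o - ell (starMap B) ρ (-(1 / ((n : ℝ) + 1)) : ℝ) o) / ((1 / ((n : ℝ) + 1) : ℝ) : ℂ))
      atTop (𝓝 (deriv (fun x ↦ ell (starMap B) ρ x o) 0)) := by
  obtain ⟨δ, η, hJ⟩ := hB.exists_jetControl (abs_nonneg o)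
  have hη := hJ.η_pos
  have hoI : o ∈ Icc (-|o| - 2) η := ⟨by linarith [neg_abs_le o], ho.trans hη.le⟩
  set ℓ₁ := deriv (fun x ↦ ell (starMap B) ρ x o) 0
  set ℓ₂ := iteratedDeriv 2 (fun x ↦ ell (starMap B) ρ x o) 0
  set C := ellBound ρ δ
  -- the Taylor bound with `a = 0`, `x = −h`
  have key : ∀ h : ℝ, 0 < h → h ≤ η / 4 →
      ‖(ell (starMap B) ρ 0 o - ell (starMap B) ρ ((-h : ℝ) : ℂ) o) / (h : ℂ) - ℓ₁‖ ≤ ‖ℓ₂‖ / 2 * h + 16 * C / η ^ 3 * h ^ 2 := by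
    intro h h0 hh
    have hx : ‖((-h : ℝ) : ℂ)‖ ≤ η / 4 := by rw [norm_real, Real.norm_eq_abs, abs_neg, abs_of_pos h0]; exact hh
    have hT := norm_ell_sub_ell_sub_le hJ ρ hoI hx (a := 0) (by simp; positivity)
    simp only [add_zero, norm_zero, mul_zero, zero_div] at hT
    rw [norm_real, Real.norm_eq_abs, abs_neg, abs_of_pos h0] at hT
    -- divide by `h`
    have hh0 : (h : ℂ) ≠ 0 := by exact_mod_cast h0.ne'
    have e : (ell (starMap B) ρ 0 o - ell (starMap B) ρ ((-h : ℝ) : ℂ) o) / (h : ℂ) - ℓ₁ =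
        -((ell (starMap B) ρ ((-h : ℝ) : ℂ) o - ell (starMap B) ρ 0 o -
            (ℓ₁ * ((-h : ℝ) : ℂ) + 2⁻¹ * ℓ₂ * ((-h : ℝ) : ℂ) ^ 2)) / (h : ℂ)) - 2⁻¹ * ℓ₂ * (h : ℂ) := by
      push_cast; field_simp; ring
    rw [e]
    refine (norm_sub_le _ _).trans ?_
    rw [norm_neg, norm_div, norm_real, Real.norm_eq_abs, abs_of_pos h0]
    have e2 : ‖(2⁻¹ : ℂ) * ℓ₂ * (h : ℂ)‖ = ‖ℓ₂‖ / 2 * h := by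
      rw [norm_mul, norm_mul, norm_real, Real.norm_eq_abs, abs_of_pos h0, norm_inv, Complex.norm_ofNat]; ring
    rw [e2, add_comm]
    gcongr
    rw [div_le_iff₀ h0]
    calc _ ≤ C * (16 * h ^ 3 / η ^ 3 + 0) := by simpa using hT
      _ = 16 * C / η ^ 3 * h ^ 2 * h := by ring
  -- squeeze
  have hbound : Tendsto (fun n : ℕ ↦ ‖ℓ₂‖ / 2 * (1 / ((n : ℝ) + 1)) + 16 * C / η ^ 3 * (1 / ((n : ℝ) + 1)) ^ 2) atTop (𝓝 0) := by
    have h1 := (tendsto_one_div_add_atTop_nhds_zero_nat (𝕜 := ℝ)).const_mul (‖ℓ₂‖ / 2)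
    have h2 := ((tendsto_one_div_add_atTop_nhds_zero_nat (𝕜 := ℝ)).pow 2).const_mul (16 * C / η ^ 3)
    simpa using h1.add h2
  have hev : ∀ᶠ n : ℕ in atTop, 1 / ((n : ℝ) + 1) ≤ η / 4 :=
    (tendsto_one_div_add_atTop_nhds_zero_nat (𝕜 := ℝ)).eventually (eventually_le_nhds (by positivity))
  refine tendsto_iff_norm_sub_tendsto_zero.2 (squeeze_zero_norm' ?_ hbound)
  filter_upwards [hev] with n hn
  rw [norm_norm]
  have := key _ (stepSeq_pos n) hn
  push_cast at this ⊢
  exact this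

/-- **`(ℓ(−2hₙ, o) − 2ℓ(−hₙ, o) + ℓ(0, o))/hₙ² → ∂ₓ²ℓ(0, o)`** for a `+`-hull and `o ≤ 0`.
[folklore] -/
theorem tendsto_secondDiff_ell_left (hB : IsPlusHull B) (ρ : ℝ) {o : ℝ} (ho : o ≤ 0) :
    Tendsto (fun n : ℕ ↦ (ell (starMap B) ρ (-(2 * (1 / ((n : ℝ) + 1))) : ℝ) o -
        2 * ell (starMap B) ρ (-(1 / ((n : ℝ) + 1)) : ℝ) o + ell (starMap B) ρ 0 o) / ((1 / ((n : ℝ) + 1) : ℝ) : ℂ) ^ 2)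
      atTop (𝓝 (iteratedDeriv 2 (fun x ↦ ell (starMap B) ρ x o) 0)) := by
  obtain ⟨δ, η, hJ⟩ := hB.exists_jetControl (abs_nonneg o)
  have hη := hJ.η_pos
  have hoI : o ∈ Icc (-|o| - 2) η := ⟨by linarith [neg_abs_le o], ho.trans hη.le⟩
  set ℓ₁ := deriv (fun x ↦ ell (starMap B) ρ x o) 0
  set ℓ₂ := iteratedDeriv 2 (fun x ↦ ell (starMap B) ρ x o) 0
  set C := ellBound ρ δ
  have taylor : ∀ h : ℝ, 0 < h → h ≤ η / 4 →
      ‖ell (starMap B) ρ ((-h : ℝ) : ℂ) o - ell (starMap B) ρ 0 o - (ℓ₁ * ((-h : ℝ) : ℂ) + 2⁻¹ * ℓ₂ * ((-h : ℝ) : ℂ) ^ 2)‖ ≤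
        16 * C / η ^ 3 * h ^ 3 := by
    intro h h0 hh
    have hx : ‖((-h : ℝ) : ℂ)‖ ≤ η / 4 := by rw [norm_real, Real.norm_eq_abs, abs_neg, abs_of_pos h0]; exact hh
    have hT := norm_ell_sub_ell_sub_le hJ ρ hoI hx (a := 0) (by simp; positivity)
    simp only [add_zero, norm_zero, mul_zero, zero_div] at hT
    rw [norm_real, Real.norm_eq_abs, abs_neg, abs_of_pos h0] at hT
    calc _ ≤ C * (16 * h ^ 3 / η ^ 3 + 0) := by simpa using hT
      _ = 16 * C / η ^ 3 * h ^ 3 := by ring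
  have key : ∀ h : ℝ, 0 < h → 2 * h ≤ η / 4 →
      ‖(ell (starMap B) ρ ((-(2 * h) : ℝ) : ℂ) o - 2 * ell (starMap B) ρ ((-h : ℝ) : ℂ) o + ell (starMap B) ρ 0 o) /
          ((h : ℝ) : ℂ) ^ 2 - ℓ₂‖ ≤ 160 * C / η ^ 3 * h := by
    intro h h0 hh
    have t1 := taylor (2 * h) (by positivity) hh
    have t2 := taylor h h0 (by linarith)
    have hh0 : ((h : ℝ) : ℂ) ≠ 0 := by exact_mod_cast h0.ne'
    set T1 := ell (starMap B) ρ ((-(2 * h) : ℝ) : ℂ) o - ell (starMap B) ρ 0 o -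
      (ℓ₁ * ((-(2 * h) : ℝ) : ℂ) + 2⁻¹ * ℓ₂ * ((-(2 * h) : ℝ) : ℂ) ^ 2) with hT1
    set T2 := ell (starMap B) ρ ((-h : ℝ) : ℂ) o - ell (starMap B) ρ 0 o -
      (ℓ₁ * ((-h : ℝ) : ℂ) + 2⁻¹ * ℓ₂ * ((-h : ℝ) : ℂ) ^ 2) with hT2
    have e : (ell (starMap B) ρ ((-(2 * h) : ℝ) : ℂ) o - 2 * ell (starMap B) ρ ((-h : ℝ) : ℂ) o + ell (starMap B) ρ 0 o) /
          ((h : ℝ) : ℂ) ^ 2 - ℓ₂ = (T1 - 2 * T2) / ((h : ℝ) : ℂ) ^ 2 := by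
      rw [hT1, hT2]; push_cast; field_simp; ring
    rw [e, norm_div, norm_pow, norm_real, Real.norm_eq_abs, abs_of_pos h0]
    rw [div_le_iff₀ (by positivity)]
    calc ‖T1 - 2 * T2‖ ≤ ‖T1‖ + ‖(2 : ℂ) * T2‖ := norm_sub_le _ _
      _ ≤ 16 * C / η ^ 3 * (2 * h) ^ 3 + 2 * (16 * C / η ^ 3 * h ^ 3) := by
          rw [norm_mul, Complex.norm_ofNat]; exact add_le_add t1 (by linarith)
      _ = 160 * C / η ^ 3 * h * h ^ 2 := by ring
  have hbound : Tendsto (fun n : ℕ ↦ 160 * C / η ^ 3 * (1 / ((n : ℝ) + 1))) atTop (𝓝 0) := by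
    simpa using (tendsto_one_div_add_atTop_nhds_zero_nat (𝕜 := ℝ)).const_mul (160 * C / η ^ 3)
  have hev : ∀ᶠ n : ℕ in atTop, 2 * (1 / ((n : ℝ) + 1)) ≤ η / 4 := by
    have := ((tendsto_one_div_add_atTop_nhds_zero_nat (𝕜 := ℝ)).const_mul 2).eventually
      (eventually_le_nhds (show (2 : ℝ) * 0 < η / 4 by simpa using by positivity))
    exact this
  refine tendsto_iff_norm_sub_tendsto_zero.2 (squeeze_zero_norm' ?_ hbound)
  filter_upwards [hev] with n hn
  rw [norm_norm]
  exact key _ (stepSeq_pos n) hn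

/-- **`(ℓ(0, o) − ℓ(0, o − hₙ))/hₙ → ∂_yℓ(0, o)`** for a `+`-hull and `o ≤ 0`. [folklore] -/
theorem tendsto_slope_ell_right (hB : IsPlusHull B) (ρ : ℝ) {o : ℝ} (ho : o ≤ 0) :
    Tendsto (fun n : ℕ ↦ (ell (starMap B) ρ 0 o - ell (starMap B) ρ 0 ((o - 1 / ((n : ℝ) + 1) : ℝ))) / ((1 / ((n : ℝ) + 1) : ℝ) : ℂ))
      atTop (𝓝 (deriv (fun y ↦ ell (starMap B) ρ 0 y) o)) := by
  obtain ⟨δ, η, hJ⟩ := hB.exists_jetControl (abs_nonneg o)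
  have hη := hJ.η_pos
  have hoI : o ∈ Icc (-|o| - 2) η := ⟨by linarith [neg_abs_le o], ho.trans hη.le⟩
  set m₁ := deriv (fun y ↦ ell (starMap B) ρ 0 y) o
  set C := ellBound ρ δ
  have key : ∀ h : ℝ, 0 < h → h ≤ η / 4 →
      ‖(ell (starMap B) ρ 0 o - ell (starMap B) ρ 0 ((o - h : ℝ) : ℂ)) / ((h : ℝ) : ℂ) - m₁‖ ≤ 8 * C / η ^ 2 * h := by
    intro h h0 hh
    have ha : ‖((-h : ℝ) : ℂ)‖ ≤ η / 4 := by rw [norm_real, Real.norm_eq_abs, abs_neg, abs_of_pos h0]; exact hh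
    have hT := norm_ell_sub_ell_sub_le hJ ρ hoI (x := 0) (by simp; positivity) ha
    simp only [norm_zero, mul_zero, zero_div, zero_mul, add_zero, zero_add, ne_eq, OfNat.ofNat_ne_zero,
      not_false_eq_true, zero_pow] at hT
    rw [norm_real, Real.norm_eq_abs, abs_neg, abs_of_pos h0] at hT
    have hh0 : ((h : ℝ) : ℂ) ≠ 0 := by exact_mod_cast h0.ne'
    have e : (ell (starMap B) ρ 0 o - ell (starMap B) ρ 0 ((o - h : ℝ) : ℂ)) / ((h : ℝ) : ℂ) - m₁ =
        -((ell (starMap B) ρ 0 ((o : ℂ) + ((-h : ℝ) : ℂ)) - ell (starMap B) ρ 0 o - m₁ * ((-h : ℝ) : ℂ)) / ((h : ℝ) : ℂ)) := by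
      have : ((o - h : ℝ) : ℂ) = (o : ℂ) + ((-h : ℝ) : ℂ) := by push_cast; ring
      rw [this]; field_simp; push_cast; ring
    rw [e, norm_neg, norm_div, norm_real, Real.norm_eq_abs, abs_of_pos h0, div_le_iff₀ h0]
    calc _ ≤ C * (8 * h ^ 2 / η ^ 2) := by simpa using hT
      _ = 8 * C / η ^ 2 * h * h := by ring
  have hbound : Tendsto (fun n : ℕ ↦ 8 * C / η ^ 2 * (1 / ((n : ℝ) + 1))) atTop (𝓝 0) := by
    simpa using (tendsto_one_div_add_atTop_nhds_zero_nat (𝕜 := ℝ)).const_mul (8 * C / η ^ 2)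
  have hev : ∀ᶠ n : ℕ in atTop, 1 / ((n : ℝ) + 1) ≤ η / 4 :=
    (tendsto_one_div_add_atTop_nhds_zero_nat (𝕜 := ℝ)).eventually (eventually_le_nhds (by positivity))
  refine tendsto_iff_norm_sub_tendsto_zero.2 (squeeze_zero_norm' ?_ hbound)
  filter_upwards [hev] with n hn
  rw [norm_norm]
  exact key _ (stepSeq_pos n) hn

end Limits

/-! ### `ℓ(E_{B_t})` at random real points is measurable -/

namespace Loewner

variable {Ω : Type*} {mΩ : MeasurableSpace Ω} {W : Ω → ℝ≥0 → ℝ} {A : Set ℂ} {t : ℝ≥0}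

/-- `E_{B_t}'(y(ω))` as a complex random variable (times `𝟙{alive}`), `y ≤ 0` measurable. [folklore] -/
theorem measurable_indicator_deriv_starMap_slidHull_comp (hc : ∀ ω, Continuous (W ω)) (hW0 : ∀ ω, W ω 0 = 0)
    (hmeas : ∀ s, s ≤ t → Measurable fun ω ↦ W ω s) (hA : IsPlusHull A) (hne : A.Nonempty)
    {y : Ω → ℝ} (hy : Measurable y) (hy0 : ∀ ω, y ω ≤ 0) :
    Measurable fun ω ↦ Set.indicator {ω | Disjoint (closedHull (W ω) t) A}
      (fun ω ↦ deriv (starMap (slidHull (W ω) A t)) (y ω)) ω := by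
  have h := measurable_indicator_starDeriv_translate_slidHull_comp hc hW0 hmeas hA hne hy hy0
  have h' : Measurable fun ω ↦ ((Set.indicator {ω | Disjoint (closedHull (W ω) t) A}
      (fun ω ↦ starDeriv (SLEKappaRho.translate (slidHull (W ω) A t) (y ω))) ω : ℝ) : ℂ) :=
    Complex.measurable_ofReal.comp h
  have he : (fun ω ↦ Set.indicator {ω | Disjoint (closedHull (W ω) t) A}
      (fun ω ↦ deriv (starMap (slidHull (W ω) A t)) (y ω)) ω) = fun ω ↦
      ((Set.indicator {ω | Disjoint (closedHull (W ω) t) A}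
        (fun ω ↦ starDeriv (SLEKappaRho.translate (slidHull (W ω) A t) (y ω))) ω : ℝ) : ℂ) := by
    funext ω
    by_cases hω : Disjoint (closedHull (W ω) t) A
    · have hmem : ω ∈ {ω | Disjoint (closedHull (W ω) t) A} := hω
      simp only [Set.indicator_of_mem hmem]
      have hB := isPlusHull_slidHull_of_disjoint (hc ω) (hW0 ω) hA hω
      rw [deriv_starMap_ofReal_eq_re hB.1 (hB.ofReal_notMem_of_nonpos (hy0 ω)), ← hullDeriv_translate hB.1
        (hB.ofReal_notMem_of_nonpos (hy0 ω)), hullDeriv_eq_starDeriv]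
    · have hmem : ω ∉ {ω | Disjoint (closedHull (W ω) t) A} := hω
      simp only [Set.indicator_of_notMem hmem, Complex.ofReal_zero]
  rw [he]; exact h'

/-- `E_{B_t}(y(ω))` as a complex random variable (times `𝟙{alive}`), `y ≤ 0` measurable. [folklore] -/
theorem measurable_indicator_starMap_slidHull_comp (hc : ∀ ω, Continuous (W ω)) (hW0 : ∀ ω, W ω 0 = 0)
    (hmeas : ∀ s, s ≤ t → Measurable fun ω ↦ W ω s) (hA : IsPlusHull A) (hne : A.Nonempty)
    {y : Ω → ℝ} (hy : Measurable y) (hy0 : ∀ ω, y ω ≤ 0) :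
    Measurable fun ω ↦ Set.indicator {ω | Disjoint (closedHull (W ω) t) A}
      (fun ω ↦ starMap (slidHull (W ω) A t) (y ω)) ω := by
  have h := measurable_indicator_re_starMap_slidHull_comp hc hW0 hmeas hA hne hy hy0
  have h' : Measurable fun ω ↦ ((Set.indicator {ω | Disjoint (closedHull (W ω) t) A}
      (fun ω ↦ (starMap (slidHull (W ω) A t) (y ω)).re) ω : ℝ) : ℂ) :=
    Complex.measurable_ofReal.comp h
  have he : (fun ω ↦ Set.indicator {ω | Disjoint (closedHull (W ω) t) A}
      (fun ω ↦ starMap (slidHull (W ω) A t) (y ω)) ω) = fun ω ↦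
      ((Set.indicator {ω | Disjoint (closedHull (W ω) t) A}
        (fun ω ↦ (starMap (slidHull (W ω) A t) (y ω)).re) ω : ℝ) : ℂ) := by
    funext ω
    by_cases hω : Disjoint (closedHull (W ω) t) A
    · have hmem : ω ∈ {ω | Disjoint (closedHull (W ω) t) A} := hω
      simp only [Set.indicator_of_mem hmem]
      have hB := isPlusHull_slidHull_of_disjoint (hc ω) (hW0 ω) hA hω
      exact starMap_ofReal_eq_re' hB.1 (hB.ofReal_notMem_of_nonpos (hy0 ω))
    · have hmem : ω ∉ {ω | Disjoint (closedHull (W ω) t) A} := hω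
      simp only [Set.indicator_of_notMem hmem, Complex.ofReal_zero]
  rw [he]; exact h'

/-- **`ω ↦ ℓ(E_{B_t(ω)})(x(ω), y(ω)) · 𝟙{alive}` is measurable** for measurable real `x, y ≤ 0`.
[cite: LawlerSchrammWerner2003Restriction, §8.4 (log M_t)] -/
theorem measurable_indicator_ell_slidHull (hc : ∀ ω, Continuous (W ω)) (hW0 : ∀ ω, W ω 0 = 0)
    (hmeas : ∀ s, s ≤ t → Measurable fun ω ↦ W ω s) (hA : IsPlusHull A) (hne : A.Nonempty) (ρ : ℝ)
    {x y : Ω → ℝ} (hx : Measurable x) (hx0 : ∀ ω, x ω ≤ 0) (hy : Measurable y) (hy0 : ∀ ω, y ω ≤ 0) :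
    Measurable fun ω ↦ Set.indicator {ω | Disjoint (closedHull (W ω) t) A}
      (fun ω ↦ ell (starMap (slidHull (W ω) A t)) ρ (x ω) (y ω)) ω := by
  classical
  set Ev : Set Ω := {ω | Disjoint (closedHull (W ω) t) A} with hEv
  have hEm : MeasurableSet Ev := measurableSet_disjoint_closedHull hc hW0 hmeas hA.1 hne
  -- the measurable ingredients
  set F₁ : Ω → ℂ := fun ω ↦ Ev.indicator (fun ω ↦ deriv (starMap (slidHull (W ω) A t)) (x ω)) ω
  set F₂ : Ω → ℂ := fun ω ↦ Ev.indicator (fun ω ↦ deriv (starMap (slidHull (W ω) A t)) (y ω)) ω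
  set G₁ : Ω → ℂ := fun ω ↦ Ev.indicator (fun ω ↦ starMap (slidHull (W ω) A t) (x ω)) ω
  set G₂ : Ω → ℂ := fun ω ↦ Ev.indicator (fun ω ↦ starMap (slidHull (W ω) A t) (y ω)) ω
  have hF₁ : Measurable F₁ := measurable_indicator_deriv_starMap_slidHull_comp hc hW0 hmeas hA hne hx hx0
  have hF₂ : Measurable F₂ := measurable_indicator_deriv_starMap_slidHull_comp hc hW0 hmeas hA hne hy hy0
  have hG₁ : Measurable G₁ := measurable_indicator_starMap_slidHull_comp hc hW0 hmeas hA hne hx hx0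
  have hG₂ : Measurable G₂ := measurable_indicator_starMap_slidHull_comp hc hW0 hmeas hA hne hy hy0
  set F₃ : Ω → ℂ := fun ω ↦ if x ω = y ω then F₂ ω else (G₁ ω - G₂ ω) / (((x ω : ℝ) : ℂ) - ((y ω : ℝ) : ℂ))
  have hF₃ : Measurable F₃ := by
    refine Measurable.ite (measurableSet_eq_fun hx hy) hF₂ ?_
    exact (hG₁.sub hG₂).div ((Complex.measurable_ofReal.comp hx).sub (Complex.measurable_ofReal.comp hy))
  set Φ : Ω → ℂ := fun ω ↦ (5 / 8 : ℂ) * Complex.log (F₁ ω) + (expB ρ : ℂ) * Complex.log (F₂ ω) +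
    (expC ρ : ℂ) * Complex.log (F₃ ω)
  have hΦ : Measurable Φ := ((hF₁.clog.const_mul _).add (hF₂.clog.const_mul _)).add (hF₃.clog.const_mul _)
  have hΦ' : Measurable fun ω ↦ Ev.indicator Φ ω := hΦ.indicator hEm
  suffices he : (fun ω ↦ Ev.indicator (fun ω ↦ ell (starMap (slidHull (W ω) A t)) ρ (x ω) (y ω)) ω) =
      fun ω ↦ Ev.indicator Φ ω by rw [he]; exact hΦ'
  funext ω
  by_cases hω : ω ∈ Ev
  · simp only [Set.indicator_of_mem hω]
    -- on the alive event the ingredients are the true values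
    have e1 : F₁ ω = deriv (starMap (slidHull (W ω) A t)) (x ω) := Set.indicator_of_mem hω _
    have e2 : F₂ ω = deriv (starMap (slidHull (W ω) A t)) (y ω) := Set.indicator_of_mem hω _
    have e3 : G₁ ω = starMap (slidHull (W ω) A t) (x ω) := Set.indicator_of_mem hω _
    have e4 : G₂ ω = starMap (slidHull (W ω) A t) (y ω) := Set.indicator_of_mem hω _
    have e5 : F₃ ω = DQ (starMap (slidHull (W ω) A t)) (x ω) (y ω) := by
      show (if x ω = y ω then F₂ ω else (G₁ ω - G₂ ω) / (((x ω : ℝ) : ℂ) - ((y ω : ℝ) : ℂ))) = _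
      by_cases hxy : x ω = y ω
      · rw [if_pos hxy, e2, hxy, DQ_same]
      · rw [if_neg hxy, e3, e4, DQ_of_ne _ (by exact_mod_cast hxy)]
    show ell (starMap (slidHull (W ω) A t)) ρ (x ω) (y ω) = Φ ω
    simp only [Φ, e1, e2, e5, ell]
  · simp only [Set.indicator_of_notMem hω]

/-! ### The jets are measurable (limits of difference quotients) -/

/-- **`ω ↦ ∂ₓℓ(E_{B_t(ω)})(0, o(ω)) · 𝟙{alive}` is measurable** (`o ≤ 0` measurable).
[cite: LawlerSchrammWerner2003Restriction, proof of Lemma 8.9 (the dW_t-coefficient of log M_t)] -/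
theorem measurable_indicator_jetL1_slidHull (hc : ∀ ω, Continuous (W ω)) (hW0 : ∀ ω, W ω 0 = 0)
    (hmeas : ∀ s, s ≤ t → Measurable fun ω ↦ W ω s) (hA : IsPlusHull A) (hne : A.Nonempty) (ρ : ℝ)
    {o : Ω → ℝ} (ho : Measurable o) (ho0 : ∀ ω, o ω ≤ 0) :
    Measurable fun ω ↦ Set.indicator {ω | Disjoint (closedHull (W ω) t) A}
      (fun ω ↦ deriv (fun x ↦ ell (starMap (slidHull (W ω) A t)) ρ x (o ω)) 0) ω := by
  set Ev : Set Ω := {ω | Disjoint (closedHull (W ω) t) A} with hEv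
  set G : ℕ → Ω → ℂ := fun n ω ↦ (Ev.indicator (fun ω ↦ ell (starMap (slidHull (W ω) A t)) ρ ((0 : ℝ) : ℂ) (o ω)) ω -
    Ev.indicator (fun ω ↦ ell (starMap (slidHull (W ω) A t)) ρ (-(1 / ((n : ℝ) + 1)) : ℝ) (o ω)) ω) /
      ((1 / ((n : ℝ) + 1) : ℝ) : ℂ) with hG
  have hGm : ∀ n, Measurable (G n) := fun n ↦
    ((measurable_indicator_ell_slidHull hc hW0 hmeas hA hne ρ measurable_const (fun _ ↦ le_rfl) ho ho0).sub
      (measurable_indicator_ell_slidHull hc hW0 hmeas hA hne ρ measurable_const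
        (fun _ ↦ by simp only [Left.neg_nonpos_iff]; positivity) ho ho0)).div_const _
  refine measurable_of_tendsto_metrizable hGm (tendsto_pi_nhds.2 fun ω ↦ ?_)
  by_cases hω : ω ∈ Ev
  · simp only [hG, Set.indicator_of_mem hω, Complex.ofReal_zero]
    exact tendsto_slope_ell_left (isPlusHull_slidHull_of_disjoint (hc ω) (hW0 ω) hA hω) ρ (ho0 ω)
  · simp only [hG, Set.indicator_of_notMem hω, sub_zero, zero_div]
    exact tendsto_const_nhds

/-- **`ω ↦ ∂ₓ²ℓ(E_{B_t(ω)})(0, o(ω)) · 𝟙{alive}` is measurable** (`o ≤ 0` measurable).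
[cite: LawlerSchrammWerner2003Restriction, proof of Lemma 8.9 (the d⟨W⟩_t-coefficient of log M_t)] -/
theorem measurable_indicator_jetL2_slidHull (hc : ∀ ω, Continuous (W ω)) (hW0 : ∀ ω, W ω 0 = 0)
    (hmeas : ∀ s, s ≤ t → Measurable fun ω ↦ W ω s) (hA : IsPlusHull A) (hne : A.Nonempty) (ρ : ℝ)
    {o : Ω → ℝ} (ho : Measurable o) (ho0 : ∀ ω, o ω ≤ 0) :
    Measurable fun ω ↦ Set.indicator {ω | Disjoint (closedHull (W ω) t) A}
      (fun ω ↦ iteratedDeriv 2 (fun x ↦ ell (starMap (slidHull (W ω) A t)) ρ x (o ω)) 0) ω := by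
  set Ev : Set Ω := {ω | Disjoint (closedHull (W ω) t) A} with hEv
  set G : ℕ → Ω → ℂ := fun n ω ↦
    (Ev.indicator (fun ω ↦ ell (starMap (slidHull (W ω) A t)) ρ (-(2 * (1 / ((n : ℝ) + 1))) : ℝ) (o ω)) ω -
      2 * Ev.indicator (fun ω ↦ ell (starMap (slidHull (W ω) A t)) ρ (-(1 / ((n : ℝ) + 1)) : ℝ) (o ω)) ω +
      Ev.indicator (fun ω ↦ ell (starMap (slidHull (W ω) A t)) ρ ((0 : ℝ) : ℂ) (o ω)) ω) /
      ((1 / ((n : ℝ) + 1) : ℝ) : ℂ) ^ 2 with hG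
  have hGm : ∀ n, Measurable (G n) := by
    intro n
    have h1 := measurable_indicator_ell_slidHull hc hW0 hmeas hA hne ρ (x := fun _ ↦ -(2 * (1 / ((n : ℝ) + 1))))
      measurable_const (fun _ ↦ by simp only [Left.neg_nonpos_iff]; positivity) ho ho0
    have h2 := measurable_indicator_ell_slidHull hc hW0 hmeas hA hne ρ (x := fun _ ↦ -(1 / ((n : ℝ) + 1)))
      measurable_const (fun _ ↦ by simp only [Left.neg_nonpos_iff]; positivity) ho ho0
    have h3 := measurable_indicator_ell_slidHull hc hW0 hmeas hA hne ρ (x := fun _ ↦ (0 : ℝ))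
      measurable_const (fun _ ↦ le_rfl) ho ho0
    exact ((h1.sub (h2.const_mul _)).add h3).div_const _
  refine measurable_of_tendsto_metrizable hGm (tendsto_pi_nhds.2 fun ω ↦ ?_)
  by_cases hω : ω ∈ Ev
  · simp only [hG, Set.indicator_of_mem hω, Complex.ofReal_zero]
    exact tendsto_secondDiff_ell_left (isPlusHull_slidHull_of_disjoint (hc ω) (hW0 ω) hA hω) ρ (ho0 ω)
  · simp only [hG, Set.indicator_of_notMem hω, mul_zero, sub_zero, add_zero, zero_div]
    exact tendsto_const_nhds

/-- **`ω ↦ ∂_yℓ(E_{B_t(ω)})(0, o(ω)) · 𝟙{alive}` is measurable** (`o ≤ 0` measurable).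
[cite: LawlerSchrammWerner2003Restriction, proof of Lemma 8.9 (the dO_t-coefficient of log M_t)] -/
theorem measurable_indicator_jetM1_slidHull (hc : ∀ ω, Continuous (W ω)) (hW0 : ∀ ω, W ω 0 = 0)
    (hmeas : ∀ s, s ≤ t → Measurable fun ω ↦ W ω s) (hA : IsPlusHull A) (hne : A.Nonempty) (ρ : ℝ)
    {o : Ω → ℝ} (ho : Measurable o) (ho0 : ∀ ω, o ω ≤ 0) :
    Measurable fun ω ↦ Set.indicator {ω | Disjoint (closedHull (W ω) t) A}
      (fun ω ↦ deriv (fun y ↦ ell (starMap (slidHull (W ω) A t)) ρ 0 y) (o ω)) ω := by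
  set Ev : Set Ω := {ω | Disjoint (closedHull (W ω) t) A} with hEv
  set G : ℕ → Ω → ℂ := fun n ω ↦ (Ev.indicator (fun ω ↦ ell (starMap (slidHull (W ω) A t)) ρ ((0 : ℝ) : ℂ) (o ω)) ω -
    Ev.indicator (fun ω ↦ ell (starMap (slidHull (W ω) A t)) ρ ((0 : ℝ) : ℂ) ((o ω - 1 / ((n : ℝ) + 1) : ℝ))) ω) /
      ((1 / ((n : ℝ) + 1) : ℝ) : ℂ) with hG
  have hGm : ∀ n, Measurable (G n) := fun n ↦
    ((measurable_indicator_ell_slidHull hc hW0 hmeas hA hne ρ measurable_const (fun _ ↦ le_rfl) ho ho0).sub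
      (measurable_indicator_ell_slidHull hc hW0 hmeas hA hne ρ measurable_const (fun _ ↦ le_rfl) (ho.sub_const _)
        (fun ω ↦ by linarith [ho0 ω, stepSeq_pos n]))).div_const _
  refine measurable_of_tendsto_metrizable hGm (tendsto_pi_nhds.2 fun ω ↦ ?_)
  by_cases hω : ω ∈ Ev
  · simp only [hG, Set.indicator_of_mem hω, Complex.ofReal_zero]
    exact tendsto_slope_ell_right (isPlusHull_slidHull_of_disjoint (hc ω) (hW0 ω) hA hω) ρ (ho0 ω)
  · simp only [hG, Set.indicator_of_notMem hω, sub_zero, zero_div]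
    exact tendsto_const_nhds

end Loewner

end Literature.Probability.RandomPlanarGeometry

end
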